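import Summits.AtomisticToContinuum.Crystallization.Theorems.ChargedEnergyGapLineMoment
import HarnessLib

/-!
# ChargedEnergyGap · NODE 83 «FibreCharge» (lens-3 g82) — file A of four: THE CUBIC FRAME OF THE EXACT CLASS (crystallography; the leaves (LS)
`CubicFrameQ cls₀ (6/5) (3/2) (679/1000) (691/1000)` and (SHELL₂) `ShellIsSecond cls₀` of NODE 82's cone PROVED)

Line of record `stmt-AtomisticToContinuum-14231` (`Summit.AtomisticToContinuum.ChargedEnergyGap`), route PricedLinkCensus; NODE 83 sits beneath NODE 82
«LineMoment» (tree `…Theorems.ChargedEnergyGapLineMomentA|B|∅`, cone of record `chargedEnergyGap_of_lineMoment_numerics`, 35 hypotheses).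

THIS FILE.  ★ `exists_cubicFrame_of_isCubicFccImage`: a cubic fcc image at nearest-neighbour distance exactly `a` IS the even cubic sub-lattice
`{c₀ + (a/√2) Σ wᵢ fᵢ : Σ wᵢ even}` of an orthonormal frame — composed from the tree's `Fcc.exists_isometry_eq_image_fccStacking` (constant Hägg word ⇒
rigid copy of `fccStacking a h`, `h = hOf a` forced by `h² = 2a²/3`), `Fcc.image_rot_fcc` (stacking coordinates ↦ cubic coordinates `b·D₃`, `b = bOf a =
a/√2`, `Fcc.mem_points_iff_even`) and `Fcc.exists_linearIsometryEquiv_of_isometry` (a Euclidean isometry is `x ↦ L x + c`).  With `a = a₀√2`: `ρ = a₀ ∈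
[0.679, 0.691]` (`cf_a0_ge` from `a0_sqrt2_cubic_window`, `a0_le_of_window`).  Then pure lattice arithmetic: `dist² = ρ² Σ(Δw)²` (`cf_dist_sq`); a pair
at distance in `(6/5, 3/2]` has `Σ(Δw)² = 4` (`3ρ² ≤ 1.433 < 1.44`, `5ρ² ≥ 2.305 > 2.25`; `cf_latt_sq_eq_four`), hence `Δw = ±2e_a` (`cf_int_sq_four`) —
the axis-`a` antipodal pole pair of the ODD hole `w = w_y ± e_a`; a site within `6/5` of both poles has `|u − w|² ≤ 2` and odd coordinate sum, so `u − w =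
±e_i` (`cf_int_unit`); conversely cross vertices are at `ρ√2 ≤ 0.978 ≤ 6/5`.  ★★★ `cubicFrameQ_exact` = (LS) and ★★★ `shellIsSecond_exact` = (SHELL₂)
(`dist = 2ρ = 2a₀`): the hypotheses `hLS` and `hSh` of the cone are DISCHARGED (NODE 83's cone has 33 hypotheses).  §A2: three index lemmas of the
tree tables `capKRow` / `capKCol` used by file B (`row ≥ 1 ⇒ depth ≥ 93.5`, `col ≥ 2 ⇒ kink ≥ 1`, `col ≥ 11 ⇒ kink ≥ 1.9`).

Imports ONLY the tree file `…ChargedEnergyGapLineMoment` (NODE 82) and `HarnessLib`; no `set_option`, no `sorry`, no instance, no notation, no `private`;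
namespace `…Theorems.ChargedEnergyGapChartDial`; new declaration names (prefix `cf_`; checked by `rg` over the tree).
-/

noncomputable section

open scoped Classical
open Literature.MathematicalPhysics.StatisticalMechanics Literature.Geometry.DiscreteGeometry
open Summit.AtomisticToContinuum.Crystallization.Theses.PricedLinkCensus
open Summit.AtomisticToContinuum.Crystallization.Theorems.ChargedEnergyGapNegative

namespace Summit.AtomisticToContinuum.Crystallization.Theorems.ChargedEnergyGapChartDial

/-! ## §A1 THE CUBIC FRAME OF THE EXACT CLASS (crystallography, PROVED): every cubic fcc image at nearest-neighbour distance exactly `a` is the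
even sub-lattice `{c₀ + ρ Σ wᵢ fᵢ : Σ wᵢ even}` of an orthonormal cubic frame with half-diagonal `ρ = a/√2` -/

section CubicFrameCrystallography

/-- The lower end of the half-diagonal window: `0.679 ≤ a₀` (from the tree window `1921/2000 ≤ a₀√2`). [formal bookkeeping] -/
theorem cf_a0_ge : (679 / 1000 : ℝ) ≤ Fcc.a0 := by
  have h2 : Real.sqrt 2 ≤ 14143 / 10000 := by
    rw [show (14143 / 10000 : ℝ) = Real.sqrt ((14143 / 10000) ^ 2) by rw [Real.sqrt_sq (by norm_num)]]
    exact Real.sqrt_le_sqrt (by norm_num)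
  have hw := a0_sqrt2_cubic_window.1
  nlinarith [Fcc.a0_pos, h2, hw, Real.sqrt_nonneg 2]

/-- ★★ **THE CUBIC FRAME OF A CUBIC fcc IMAGE** (structure theorem): a cubic fcc image `S` at nearest-neighbour distance exactly `a > 0` is the set
of lattice points `cubicPt c₀ f (a/√2) w`, `Σ wᵢ` even, of an orthonormal frame `f` — composed from the tree's `Fcc.exists_isometry_eq_image_fccStacking`
(constant Hägg word ⇒ rigid copy of `fccStacking a h`), `Fcc.image_rot_fcc` (stacking ↦ cubic coordinates `b·D₃`, `b = a/√2`) and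
`Fcc.exists_linearIsometryEquiv_of_isometry` (Euclidean isometries are rigid motions). -/
theorem exists_cubicFrame_of_isCubicFccImage {a : ℝ} (ha : 0 < a) {S : Set E3} (hS : IsCubicFccImage a a S) :
    ∃ (c₀ : E3) (f : Fin 3 → E3), Orthonormal ℝ f ∧
      ∀ z : E3, z ∈ S ↔ ∃ w : Fin 3 → ℤ, Even (∑ i, w i) ∧ z = cubicPt c₀ f (Fcc.bOf a) w := by
  obtain ⟨a', h, s, g, ⟨ha₁, ha₂⟩, ⟨hh, hh2⟩, hH, hfcc, hg, hP⟩ := hS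
  obtain rfl : a' = a := le_antisymm ha₂ ha₁
  have hhO : h = Fcc.hOf a' := (sq_eq_sq₀ hh.le (Fcc.hOf_pos ha).le).1 (by rw [hh2, Fcc.hOf_sq])
  subst hhO
  obtain ⟨g₀, hg₀, hst⟩ := Fcc.exists_isometry_eq_image_fccStacking hH hfcc a' (Fcc.hOf a')
  obtain ⟨L, c, hLc⟩ := Fcc.exists_linearIsometryEquiv_of_isometry Fcc.isometry_rot
  have hmem : ∀ y : E3, y ∈ fccStacking a' (Fcc.hOf a') ↔
      ∃ w : Fin 3 → ℤ, Even (∑ i, w i) ∧ L y + c = Fcc.vec (Fcc.bOf a') w := by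
    intro y
    rw [← Fcc.isometry_rot.injective.mem_set_image, Fcc.image_rot_fcc a' ha, Fcc.mem_points_iff_even, hLc]
  have hG : Isometry (fun x : E3 => g (g₀ (L.symm (x - c)))) :=
    Isometry.of_dist_eq fun x y => by rw [hg.dist_eq, hg₀.dist_eq, L.symm.dist_map, dist_sub_right]
  obtain ⟨L', c', hG'⟩ := Fcc.exists_linearIsometryEquiv_of_isometry hG
  have hvec : ∀ w : Fin 3 → ℤ, ∑ i, ((w i : ℝ) * Fcc.bOf a') • (EuclideanSpace.basisFun (Fin 3) ℝ) i = Fcc.vec (Fcc.bOf a') w := by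
    intro w
    conv_rhs => rw [← (EuclideanSpace.basisFun (Fin 3) ℝ).sum_repr (Fcc.vec (Fcc.bOf a') w)]
    exact Finset.sum_congr rfl (fun i _ => by rw [EuclideanSpace.basisFun_repr, Fcc.vec_apply])
  have hcub : ∀ w : Fin 3 → ℤ, cubicPt c' (fun i => L' ((EuclideanSpace.basisFun (Fin 3) ℝ) i)) (Fcc.bOf a') w =
      L' (Fcc.vec (Fcc.bOf a') w) + c' := by
    intro w
    unfold cubicPt
    rw [← hvec, map_sum, add_comm]
    simp_rw [LinearIsometryEquiv.map_smul]
  refine ⟨c', fun i => L' ((EuclideanSpace.basisFun (Fin 3) ℝ) i),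
    (EuclideanSpace.basisFun (Fin 3) ℝ).orthonormal.comp_linearIsometryEquiv L', fun z => ?_⟩
  rw [hP, hst, Set.image_image]
  constructor
  · rintro ⟨y, hy, rfl⟩
    obtain ⟨w, hw, hyw⟩ := (hmem y).1 hy
    refine ⟨w, hw, ?_⟩
    rw [hcub, ← hyw, ← hG' (L y + c)]
    simp
  · rintro ⟨w, hw, rfl⟩
    refine ⟨L.symm (Fcc.vec (Fcc.bOf a') w - c), (hmem _).2 ⟨w, hw, by simp⟩, ?_⟩
    rw [hcub]
    exact hG' _

/-- Squared distances of frame lattice points: `dist² = ρ² Σ (uᵢ − u'ᵢ)²` (Pythagoras in the orthonormal frame). [formal bookkeeping] -/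
theorem cf_dist_sq {c₀ : E3} {f : Fin 3 → E3} (hf : Orthonormal ℝ f) (ρ : ℝ) (u u' : Fin 3 → ℤ) :
    dist (cubicPt c₀ f ρ u) (cubicPt c₀ f ρ u') ^ 2 = ρ ^ 2 * ((∑ i, (u i - u' i) ^ 2 : ℤ) : ℝ) := by
  have hsub : cubicPt c₀ f ρ u - cubicPt c₀ f ρ u' = ∑ i, (((u i : ℝ) - u' i) * ρ) • f i := by
    unfold cubicPt
    rw [add_sub_add_left_eq_sub, ← Finset.sum_sub_distrib]
    exact Finset.sum_congr rfl (fun i _ => by rw [← sub_smul, ← sub_mul])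
  rw [dist_eq_norm, hsub, ← real_inner_self_eq_norm_sq, hf.inner_sum]
  push_cast
  rw [Finset.mul_sum]
  exact Finset.sum_congr rfl (fun i _ => by simp; ring)

/-- THE SHELL WINDOW IS THE SECOND SHELL: two frame lattice points at distance in `(6/5, 3/2]`, `ρ ∈ [0.679, 0.691]`, differ by an integer vector of
squared length exactly `4` (`3 ρ² ≤ 1.433 < 1.44` and `5 ρ² ≥ 2.305 > 2.25`). [formal bookkeeping] -/
theorem cf_latt_sq_eq_four {c₀ : E3} {f : Fin 3 → E3} (hf : Orthonormal ℝ f) {ρ : ℝ} (hρ₁ : 679 / 1000 ≤ ρ) (hρ₂ : ρ ≤ 691 / 1000)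
    (u u' : Fin 3 → ℤ) (h1 : 6 / 5 < dist (cubicPt c₀ f ρ u) (cubicPt c₀ f ρ u')) (h2 : dist (cubicPt c₀ f ρ u) (cubicPt c₀ f ρ u') ≤ 3 / 2) :
    (∑ i, (u i - u' i) ^ 2 : ℤ) = 4 := by
  have hd := cf_dist_sq (c₀ := c₀) hf ρ u u'
  have hsq1 : (6 / 5 : ℝ) ^ 2 < dist (cubicPt c₀ f ρ u) (cubicPt c₀ f ρ u') ^ 2 := by gcongr
  have hsq2 : dist (cubicPt c₀ f ρ u) (cubicPt c₀ f ρ u') ^ 2 ≤ (3 / 2 : ℝ) ^ 2 := by gcongr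
  rw [hd] at hsq1 hsq2
  have hle : (∑ i, (u i - u' i) ^ 2 : ℤ) ≤ 4 := by
    by_contra hc
    have h5 : (5 : ℝ) ≤ ((∑ i, (u i - u' i) ^ 2 : ℤ) : ℝ) := by exact_mod_cast (show (5 : ℤ) ≤ _ by omega)
    nlinarith
  have hge : 4 ≤ (∑ i, (u i - u' i) ^ 2 : ℤ) := by
    by_contra hc
    have h3 : ((∑ i, (u i - u' i) ^ 2 : ℤ) : ℝ) ≤ 3 := by exact_mod_cast (show _ ≤ (3 : ℤ) by omega)
    have h0z : (0 : ℤ) ≤ ∑ i, (u i - u' i) ^ 2 := Finset.sum_nonneg (fun i _ => sq_nonneg (u i - u' i))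
    have h0 : (0 : ℝ) ≤ ((∑ i, (u i - u' i) ^ 2 : ℤ) : ℝ) := by exact_mod_cast h0z
    nlinarith
  omega

/-- Integer vectors of squared length `4` are `±2 e_a`. [formal bookkeeping] -/
theorem cf_int_sq_four (v : Fin 3 → ℤ) (h : ∑ i, v i ^ 2 = 4) : ∃ (a : Fin 3) (b : Bool), v = (2 * poleSign b) • axisZ a := by
  simp only [Fin.sum_univ_three] at h
  have h0 : v 0 ≤ 2 := by nlinarith [sq_nonneg (v 1), sq_nonneg (v 2)]
  have h0' : -2 ≤ v 0 := by nlinarith [sq_nonneg (v 1), sq_nonneg (v 2)]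
  have h1 : v 1 ≤ 2 := by nlinarith [sq_nonneg (v 0), sq_nonneg (v 2)]
  have h1' : -2 ≤ v 1 := by nlinarith [sq_nonneg (v 0), sq_nonneg (v 2)]
  have h2 : v 2 ≤ 2 := by nlinarith [sq_nonneg (v 0), sq_nonneg (v 1)]
  have h2' : -2 ≤ v 2 := by nlinarith [sq_nonneg (v 0), sq_nonneg (v 1)]
  have key : ∀ (a : Fin 3) (b : Bool), v 0 = ((2 * poleSign b) • axisZ a) 0 → v 1 = ((2 * poleSign b) • axisZ a) 1 →
      v 2 = ((2 * poleSign b) • axisZ a) 2 → ∃ (a : Fin 3) (b : Bool), v = (2 * poleSign b) • axisZ a := by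
    intro a b e0 e1 e2
    refine ⟨a, b, funext fun i => ?_⟩
    fin_cases i
    · exact e0
    · exact e1
    · exact e2
  interval_cases h₀ : v 0 <;> interval_cases h₁ : v 1 <;> interval_cases h₂ : v 2 <;> norm_num at h
  · exact key 0 false (by simp [poleSign, axisZ]) (by simp [poleSign, axisZ]) (by simp [poleSign, axisZ])
  · exact key 1 false (by simp [poleSign, axisZ]) (by simp [poleSign, axisZ]) (by simp [poleSign, axisZ])
  · exact key 2 false (by simp [poleSign, axisZ]) (by simp [poleSign, axisZ]) (by simp [poleSign, axisZ])
  · exact key 2 true (by simp [poleSign, axisZ]) (by simp [poleSign, axisZ]) (by simp [poleSign, axisZ])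
  · exact key 1 true (by simp [poleSign, axisZ]) (by simp [poleSign, axisZ]) (by simp [poleSign, axisZ])
  · exact key 0 true (by simp [poleSign, axisZ]) (by simp [poleSign, axisZ]) (by simp [poleSign, axisZ])

/-- Integer vectors of squared length `≤ 2` and ODD coordinate sum are `± e_i` (squared length `≡` coordinate sum mod `2`). [formal bookkeeping] -/
theorem cf_int_unit (q : Fin 3 → ℤ) (h : ∑ i, q i ^ 2 ≤ 2) (hodd : Odd (∑ i, q i)) : ∃ (i : Fin 3) (b : Bool), q = poleSign b • axisZ i := by
  simp only [Fin.sum_univ_three] at h hodd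
  have h0 : q 0 ≤ 1 := by nlinarith [sq_nonneg (q 1), sq_nonneg (q 2)]
  have h0' : -1 ≤ q 0 := by nlinarith [sq_nonneg (q 1), sq_nonneg (q 2)]
  have h1 : q 1 ≤ 1 := by nlinarith [sq_nonneg (q 0), sq_nonneg (q 2)]
  have h1' : -1 ≤ q 1 := by nlinarith [sq_nonneg (q 0), sq_nonneg (q 2)]
  have h2 : q 2 ≤ 1 := by nlinarith [sq_nonneg (q 0), sq_nonneg (q 1)]
  have h2' : -1 ≤ q 2 := by nlinarith [sq_nonneg (q 0), sq_nonneg (q 1)]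
  have key : ∀ (a : Fin 3) (b : Bool), q 0 = (poleSign b • axisZ a) 0 → q 1 = (poleSign b • axisZ a) 1 →
      q 2 = (poleSign b • axisZ a) 2 → ∃ (i : Fin 3) (b : Bool), q = poleSign b • axisZ i := by
    intro a b e0 e1 e2
    refine ⟨a, b, funext fun i => ?_⟩
    fin_cases i
    · exact e0
    · exact e1
    · exact e2
  interval_cases h₀ : q 0 <;> interval_cases h₁ : q 1 <;> interval_cases h₂ : q 2 <;> (try norm_num at h) <;> (try norm_num at hodd)
  · exact key 0 false (by simp [poleSign, axisZ]) (by simp [poleSign, axisZ]) (by simp [poleSign, axisZ])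
  · exact key 1 false (by simp [poleSign, axisZ]) (by simp [poleSign, axisZ]) (by simp [poleSign, axisZ])
  · exact key 2 false (by simp [poleSign, axisZ]) (by simp [poleSign, axisZ]) (by simp [poleSign, axisZ])
  · exact key 2 true (by simp [poleSign, axisZ]) (by simp [poleSign, axisZ]) (by simp [poleSign, axisZ])
  · exact key 1 true (by simp [poleSign, axisZ]) (by simp [poleSign, axisZ]) (by simp [poleSign, axisZ])
  · exact key 0 true (by simp [poleSign, axisZ]) (by simp [poleSign, axisZ]) (by simp [poleSign, axisZ])

/-- `poleSign (!b) = −poleSign b`. [formal bookkeeping] -/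
theorem cf_poleSign_not (b : Bool) : poleSign (!b) = -poleSign b := by
  cases b <;> simp [poleSign]

/-- `poleSign b = ±1` is odd. [formal bookkeeping] -/
theorem cf_odd_poleSign (b : Bool) : Odd (poleSign b) := by
  cases b <;> simp [poleSign]

/-- Coordinate sum along a lattice line: `Σᵢ (k + t e_a)ᵢ = Σᵢ kᵢ + t`. [formal bookkeeping] -/
theorem cf_sum_add_zsmul_axisZ (k : Fin 3 → ℤ) (t : ℤ) (a : Fin 3) : ∑ i, (k + t • axisZ a) i = (∑ i, k i) + t := by
  simp only [Pi.add_apply, Pi.smul_apply, smul_eq_mul, Finset.sum_add_distrib, axisZ, mul_ite, mul_one, mul_zero,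
    Finset.sum_ite_eq', Finset.mem_univ, if_true]

/-- Coordinate sum of a hole vertex: `Σᵢ (holeVertex w (a, b))ᵢ = Σᵢ wᵢ ± 1`. [formal bookkeeping] -/
theorem cf_sum_holeVertex (w : Fin 3 → ℤ) (u : Fin 3 × Bool) : ∑ i, holeVertex w u i = (∑ i, w i) + poleSign u.2 := by
  unfold holeVertex
  exact cf_sum_add_zsmul_axisZ w (poleSign u.2) u.1

/-- Squared lattice distance from `u` to the vertex `(a, b)` of the hole `w`, expanded. [formal bookkeeping] -/
theorem cf_sq_sub_holeVertex (u w : Fin 3 → ℤ) (a : Fin 3) (b : Bool) :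
    ∑ j, (u j - holeVertex w (a, b) j) ^ 2 = (∑ j, (u j - w j) ^ 2) - 2 * poleSign b * (u a - w a) + 1 := by
  have hp : poleSign b ^ 2 = 1 := by cases b <;> simp [poleSign]
  fin_cases a <;> simp [holeVertex, axisZ, Fin.sum_univ_three] <;> nlinarith [hp]

/-- Two vertices of one hole on DIFFERENT axes are at squared lattice distance `2`. [formal bookkeeping] -/
theorem cf_sq_holeVertex_cross (w : Fin 3 → ℤ) {i a : Fin 3} (hia : i ≠ a) (c b : Bool) :
    ∑ j, (holeVertex w (i, c) j - holeVertex w (a, b) j) ^ 2 = 2 := by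
  have hb : poleSign b ^ 2 = 1 := by cases b <;> simp [poleSign]
  have hc : poleSign c ^ 2 = 1 := by cases c <;> simp [poleSign]
  fin_cases i <;> fin_cases a <;> first | exact absurd rfl hia | (simp [holeVertex, axisZ, Fin.sum_univ_three]; nlinarith [hb, hc])

/-- A lattice pair at distance `≤ 6/5` (`ρ ≥ 0.679`) has squared lattice distance `≤ 3` (`4ρ² ≥ 1.84 > 1.44`). [formal bookkeeping] -/
theorem cf_latt_sq_le_three {c₀ : E3} {f : Fin 3 → E3} (hf : Orthonormal ℝ f) {ρ : ℝ} (hρ₁ : 679 / 1000 ≤ ρ) (u u' : Fin 3 → ℤ)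
    (h : dist (cubicPt c₀ f ρ u) (cubicPt c₀ f ρ u') ≤ 6 / 5) : (∑ i, (u i - u' i) ^ 2 : ℤ) ≤ 3 := by
  have hd := cf_dist_sq (c₀ := c₀) hf ρ u u'
  have hsq : dist (cubicPt c₀ f ρ u) (cubicPt c₀ f ρ u') ^ 2 ≤ (6 / 5 : ℝ) ^ 2 := by gcongr
  rw [hd] at hsq
  by_contra hc
  have h4 : (4 : ℝ) ≤ ((∑ i, (u i - u' i) ^ 2 : ℤ) : ℝ) := by exact_mod_cast (show (4 : ℤ) ≤ _ by omega)
  nlinarith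

/-- A lattice pair at squared lattice distance `2` is at distance `ρ√2 ≤ 0.978 ≤ 6/5` (`ρ ≤ 0.691`). [formal bookkeeping] -/
theorem cf_dist_le_of_sq_two {c₀ : E3} {f : Fin 3 → E3} (hf : Orthonormal ℝ f) {ρ : ℝ} (hρ₀ : 0 ≤ ρ) (hρ₂ : ρ ≤ 691 / 1000)
    (u u' : Fin 3 → ℤ) (h : (∑ i, (u i - u' i) ^ 2 : ℤ) = 2) : dist (cubicPt c₀ f ρ u) (cubicPt c₀ f ρ u') ≤ 6 / 5 := by
  have hd := cf_dist_sq (c₀ := c₀) hf ρ u u'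
  rw [h] at hd
  push_cast at hd
  nlinarith [dist_nonneg (x := cubicPt c₀ f ρ u) (y := cubicPt c₀ f ρ u'), mul_nonneg hρ₀ hρ₀, mul_le_mul hρ₂ hρ₂ hρ₀ (by norm_num)]

/-- ★★★ **(LS) PROVED AT THE DESIGNATE**: the exact cubic class `cls₀ = IsCubicFccImage (a₀√2) (a₀√2)` admits a cubic frame with half-diagonal
`ρ = a₀ ∈ [0.679, 0.691]` for the mid-pair window `(6/5, 3/2]`: every reference IS the even cubic sub-lattice (`exists_cubicFrame_of_isCubicFccImage`), a
mid pair differs by `±2e_a` (`cf_latt_sq_eq_four`, `cf_int_sq_four`) so it is the axis-`a` antipodal pair of the hole `w = w_y ± e_a` (odd), and the sites of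
`InOct` are exactly the six hole vertices (`cf_int_unit`: within `6/5` of both poles ⇒ `|u − w|² ≤ 2`, odd ⇒ `u − w = ±e_i`; conversely cross vertices are
at `ρ√2 ≤ 6/5`).  This DISCHARGES the leaf `hLS` of NODE 82's cone. -/
theorem cubicFrameQ_exact : CubicFrameQ cls₀ (6 / 5) (3 / 2) (679 / 1000) (691 / 1000) := by
  intro P hP
  have ha : 0 < Fcc.a0 * Real.sqrt 2 := mul_pos Fcc.a0_pos (Real.sqrt_pos.2 (by norm_num))
  obtain ⟨c₀, f, hf, hmem⟩ := exists_cubicFrame_of_isCubicFccImage ha hP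
  rw [Fcc.bOf_self_mul_sqrt2] at hmem
  refine ⟨c₀, f, Fcc.a0, hf, cf_a0_ge, a0_le_of_window, hmem, ?_⟩
  intro y z hy hz h1 h2
  obtain ⟨wy, hwy, rfl⟩ := (hmem y).1 hy
  obtain ⟨wz, hwz, rfl⟩ := (hmem z).1 hz
  have h4 := cf_latt_sq_eq_four hf cf_a0_ge a0_le_of_window wz wy (by rwa [dist_comm]) (by rwa [dist_comm])
  obtain ⟨a, b, hv⟩ := cf_int_sq_four (wz - wy) (by simpa only [Pi.sub_apply] using h4)
  obtain ⟨w, hw⟩ : ∃ w : Fin 3 → ℤ, w = holeVertex wy (a, b) := ⟨_, rfl⟩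
  have hwy' : wy = holeVertex w (a, !b) := by
    rw [hw]
    show wy = wy + poleSign b • axisZ a + poleSign (!b) • axisZ a
    rw [cf_poleSign_not, neg_smul, add_neg_cancel_right]
  have hwz' : wz = holeVertex w (a, b) := by
    rw [hw]
    show wz = wy + poleSign b • axisZ a + poleSign b • axisZ a
    rw [add_assoc, ← add_smul, ← two_mul]
    exact sub_eq_iff_eq_add'.1 hv
  subst hwy' hwz'
  clear hv hw h4
  have hwodd : Odd (∑ i, w i) := by
    rw [cf_sum_holeVertex] at hwy
    simpa using hwy.sub_odd (cf_odd_poleSign (!b))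
  have hyv : cubicPt c₀ f Fcc.a0 (holeVertex w (a, !b)) = octVertex (cubicPt c₀ f Fcc.a0 w) f Fcc.a0 a (!b) :=
    lm_cubicPt_holeVertex c₀ f Fcc.a0 w (a, !b)
  have hzv : cubicPt c₀ f Fcc.a0 (holeVertex w (a, b)) = octVertex (cubicPt c₀ f Fcc.a0 w) f Fcc.a0 a b :=
    lm_cubicPt_holeVertex c₀ f Fcc.a0 w (a, b)
  have hmemV : ∀ (i : Fin 3) (c : Bool), cubicPt c₀ f Fcc.a0 (holeVertex w (i, c)) ∈ P.points := by
    intro i c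
    refine (hmem _).2 ⟨_, ?_, rfl⟩
    rw [cf_sum_holeVertex]
    exact hwodd.add_odd (cf_odd_poleSign c)
  refine ⟨w, a, b, hwodd, hyv, hzv, fun x => ⟨?_, ?_⟩⟩
  · rintro ⟨hx, hcase⟩
    obtain ⟨u, hu, rfl⟩ := (hmem x).1 hx
    rcases hcase with hxy | hxz | ⟨hdy, hdz⟩
    · exact ⟨a, !b, by rw [hxy]; exact hyv⟩
    · exact ⟨a, b, by rw [hxz]; exact hzv⟩
    · have h3y := cf_latt_sq_le_three hf cf_a0_ge u (holeVertex w (a, !b)) (by rw [dist_comm]; exact hdy)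
      have h3z := cf_latt_sq_le_three hf cf_a0_ge u (holeVertex w (a, b)) (by rw [dist_comm]; exact hdz)
      rw [cf_sq_sub_holeVertex, cf_poleSign_not] at h3y
      rw [cf_sq_sub_holeVertex] at h3z
      have hq : ∑ j, (u j - w j) ^ 2 ≤ 2 := by linarith
      have hpar : Odd (∑ j, (u j - w j)) := by
        rw [Finset.sum_sub_distrib]
        exact hu.sub_odd hwodd
      obtain ⟨i, c, hqv⟩ := cf_int_unit (u - w) (by simpa only [Pi.sub_apply] using hq) (by simpa only [Pi.sub_apply] using hpar)
      refine ⟨i, c, ?_⟩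
      have hu' : u = holeVertex w (i, c) := sub_eq_iff_eq_add'.1 hqv
      rw [hu']
      exact lm_cubicPt_holeVertex c₀ f Fcc.a0 w (i, c)
  · rintro ⟨i, c, rfl⟩
    have e := lm_cubicPt_holeVertex c₀ f Fcc.a0 w (i, c)
    dsimp only at e
    rw [← e]
    refine ⟨hmemV i c, ?_⟩
    by_cases hia : i = a
    · subst hia
      cases b <;> cases c
      · exact Or.inr (Or.inl rfl)
      · exact Or.inl rfl
      · exact Or.inl rfl
      · exact Or.inr (Or.inl rfl)
    · refine Or.inr (Or.inr ⟨?_, ?_⟩)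
      · rw [dist_comm]
        exact cf_dist_le_of_sq_two hf Fcc.a0_pos.le a0_le_of_window _ _ (cf_sq_holeVertex_cross w hia c (!b))
      · rw [dist_comm]
        exact cf_dist_le_of_sq_two hf Fcc.a0_pos.le a0_le_of_window _ _ (cf_sq_holeVertex_cross w hia c b)

/-- ★★★ **(SHELL₂) PROVED**: in a reference of the exact cubic class, two points at distance in `(6/5, 3/2]` are at distance EXACTLY `2a₀` (they differ
by `±2e_a` in the cubic frame of half-diagonal `a₀`).  This DISCHARGES the leaf `hSh : ShellIsSecond cls₀` of the cone. -/
theorem shellIsSecond_exact : ShellIsSecond cls₀ := by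
  intro P hP y hy z hz h1 h2
  have ha : 0 < Fcc.a0 * Real.sqrt 2 := mul_pos Fcc.a0_pos (Real.sqrt_pos.2 (by norm_num))
  obtain ⟨c₀, f, hf, hmem⟩ := exists_cubicFrame_of_isCubicFccImage ha hP
  rw [Fcc.bOf_self_mul_sqrt2] at hmem
  obtain ⟨wy, -, rfl⟩ := (hmem y).1 hy
  obtain ⟨wz, -, rfl⟩ := (hmem z).1 hz
  have h4 := cf_latt_sq_eq_four hf cf_a0_ge a0_le_of_window wy wz h1 h2
  have hd := cf_dist_sq (c₀ := c₀) hf Fcc.a0 wy wz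
  rw [h4] at hd
  push_cast at hd
  exact (sq_eq_sq₀ dist_nonneg (by linarith [Fcc.a0_pos])).1 (by rw [hd]; ring)

end CubicFrameCrystallography

/-! ## §A2 Table index lemmas (for file B) (row `≥ 1` ⇔ depth `≥ 93.5`; kink column `≥ 2` ⇔ kink `≥ 1`; column `≥ 11` ⇔ kink `≥ 1.9`) -/

section TableIndex

/-- Row `≥ 1` of the table means min-depth `≥ 93.5`. [formal bookkeeping] -/
theorem fc_le_of_capKRow (x : ℝ) (h : 1 ≤ capKRow x) : 187 / 2 ≤ x := by
  by_contra hx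
  rw [not_le] at hx
  unfold capKRow at h
  rw [if_pos hx] at h
  exact absurd h (by norm_num)

/-- Kink column `≥ 2` means kink `≥ 1`. [formal bookkeeping] -/
theorem fc_le_of_capKCol_two (J : ℝ) (h : 2 ≤ capKCol J) : 1 ≤ J := by
  by_contra hJ
  rw [not_le] at hJ
  unfold capKCol at h
  by_cases h1 : J < 1 / 2
  · rw [if_pos h1] at h; exact absurd h (by norm_num)
  · rw [if_neg h1, if_pos hJ] at h; exact absurd h (by norm_num)

/-- Kink column `≥ 11` means kink `≥ 1.9`. [formal bookkeeping] -/
theorem fc_le_of_capKCol_eleven (J : ℝ) (h : 11 ≤ capKCol J) : 19 / 10 ≤ J := by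
  unfold capKCol at h
  by_cases h1 : J < 1 / 2
  · rw [if_pos h1] at h; exact absurd h (by norm_num)
  rw [if_neg h1] at h
  by_cases h2 : J < 1
  · rw [if_pos h2] at h; exact absurd h (by norm_num)
  rw [if_neg h2] at h
  rw [not_lt] at h2
  by_cases h3 : J < 2
  · rw [if_pos h3] at h
    have h9 : 9 ≤ ⌊(J - 1) * 10⌋₊ := by omega
    have h9' := (Nat.le_floor_iff (by nlinarith : 0 ≤ (J - 1) * 10)).1 h9
    push_cast at h9'
    linarith
  · rw [not_lt] at h3; linarith

end TableIndex

end Summit.AtomisticToContinuum.Crystallization.Theorems.ChargedEnergyGapChartDial
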